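import Summits.AtomisticToContinuum.HydrodynamicLimit.Theorems.CollisionIsometryCLTAdaptedWeightCLTSustainedAnisotropy
import Summits.AtomisticToContinuum.HydrodynamicLimit.Theorems.CollisionIsometryCLTAdaptedWeightCLTCBEqRungCore

/-!
# Equilibrium rung of `stub_reynolds` (line `sustained-anisotropy-superexp`, crux stmt-AtomisticToContinuum-14868):
# the energy-weighted Reynolds factor under independent Gaussian velocities

Support file (`--supports stmt-AtomisticToContinuum-14868`, anchor `stub_reynolds_gauss_anchor`) of the stub worker of
`stub_reynolds`; second file of the EQUILIBRIUM RUNG of the sub-block Reynolds remainder (first: `…SAReynoldsPacking`).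
Under the product law `⊗ᵢ N(u, θ𝟙)` of `N + 1` independent velocities, with CONVEX block ratios `q` and a ROW-CONVEX matrix
of cell shares `P`, the sub-block velocity of particle `k` is `g_k = Σⱼ (P k j − q j)(vⱼ − u)` (cell minus block velocity),
its intra-cell peculiar velocity is `d_k = (v_k − u) − Σⱼ P k j (vⱼ − u)`, and the line's energy weight and Reynolds factor
at a block are `(W/M)·T`, `(W/M)·R` with `T = Σᵢ qᵢ (1 + ‖dᵢ‖² + ‖dᵢ‖⁴ + ‖gᵢ‖²)`, `R = Σ_k q_k (‖g_k‖² + ‖g_k‖⁴)`.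
MAIN RESULT (`lintegral_TR_le`): `E (T·R) ≤ (3θ Σ_k q_k s_k)^{1/2} · K₀^{1/2}`, `s_k = Σⱼ (P k j − q j)²`,
`K₀ = 104 (1 + 2¹⁶ m₁₆)`: Cauchy–Schwarz in `(k, v)` splits `T·R` into the EXACT second moment
`E Σ_k q_k ‖g_k‖² = 3θ Σ_k q_k s_k` (`EqRung.lintegral_norm_eta_sq`, signed coefficients) and a crude moment `≤ K₀`
(Jensen, `(a+b)ⁿ ≤ 2ⁿ⁻¹(aⁿ+bⁿ)`, one-particle moments). The block objects `g, d, T, R` enter as function arguments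
WITH THEIR DEFINING EQUATIONS (pure proof file), instantiated by `rfl` in `…SAReynoldsStatics`.

References: H. Spohn, *Large Scale Dynamics of Interacting Particles* (1991), Part I §2.3 [Spohn1991].
-/

namespace Summit.AtomisticToContinuum.HydrodynamicLimit.Theorems.SustainedAnisotropy

open scoped BigOperators Topology Classical MeasureTheory ENNReal InnerProductSpace
open Filter Set MeasureTheory ProbabilityTheory
open Literature.Analysis.FluidPDE
open Summit.AtomisticToContinuum.HydrodynamicLimit.Theorems.ContactSourceDuhamel
open Summit.AtomisticToContinuum.HydrodynamicLimit.Theorems.ContactSourceDuhamel.TimeLocal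
open Summit.AtomisticToContinuum.HydrodynamicLimit.Theorems.ContactBalance
open Literature.MathematicalPhysics.KineticTheory (gaussMeasure)

noncomputable section

namespace Reynolds

variable (u : V3) (θ : ℝ) {N : ℕ} (q : Fin (N + 1) → ℝ) (P : Fin (N + 1) → Fin (N + 1) → ℝ)
  (g d : Fin (N + 1) → (Fin (N + 1) → V3) → V3) (T R : (Fin (N + 1) → V3) → ℝ)

/-- Jensen for convex weights: `(Σ qᵢ zᵢ)ⁿ ≤ Σ qᵢ zᵢⁿ` (`zᵢ ≥ 0`). -/
theorem jensen_pow (hq0 : ∀ i, 0 ≤ q i) (hq1 : ∑ i, q i = 1) {z : Fin (N + 1) → ℝ} (hz : ∀ i, 0 ≤ z i)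
    (n : ℕ) : (∑ i, q i * z i) ^ n ≤ ∑ i, q i * z i ^ n :=
  Real.pow_arith_mean_le_arith_mean_pow Finset.univ q z (fun i _ => hq0 i) hq1 (fun i _ => hz i) n

/-! ## The sub-block velocity `g_k` and the intra-cell peculiar velocity `d_k`: crude moments -/

/-- `‖g_k‖ ≤ Σⱼ P k j ‖vⱼ − u‖ + Σⱼ qⱼ ‖vⱼ − u‖` (difference of two convex combinations). -/
theorem norm_g_le (hq0 : ∀ i, 0 ≤ q i) (hP0 : ∀ k j, 0 ≤ P k j)
    (hg : g = fun k v => ∑ j, (P k j - q j) • (v j - u)) (k : Fin (N + 1)) (v : Fin (N + 1) → V3) :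
    ‖g k v‖ ≤ (∑ j, P k j * ‖v j - u‖ ^ 1) + ∑ j, q j * ‖v j - u‖ ^ 1 := by
  have he : g k v = (∑ j, P k j • (v j - u)) - ∑ j, q j • (v j - u) := by
    rw [hg]
    simp only [sub_smul, Finset.sum_sub_distrib]
  rw [he]
  refine (norm_sub_le _ _).trans (add_le_add ?_ ?_)
  · exact EqRung.norm_eta_le u (P k) (fun v => ∑ j, P k j • (v j - u)) (hP0 k) rfl v
  · exact EqRung.norm_eta_le u q (fun v => ∑ j, q j • (v j - u)) hq0 rfl v

/-- `‖d_k‖ ≤ ‖v_k − u‖ + Σⱼ P k j ‖vⱼ − u‖`. -/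
theorem norm_d_le (hP0 : ∀ k j, 0 ≤ P k j)
    (hd : d = fun k v => (v k - u) - ∑ j, P k j • (v j - u)) (k : Fin (N + 1)) (v : Fin (N + 1) → V3) :
    ‖d k v‖ ≤ ‖v k - u‖ ^ 1 + ∑ j, P k j * ‖v j - u‖ ^ 1 := by
  rw [hd, pow_one]
  refine (norm_sub_le _ _).trans (add_le_add le_rfl ?_)
  exact EqRung.norm_eta_le u (P k) (fun v => ∑ j, P k j • (v j - u)) (hP0 k) rfl v

/-- `‖g_k‖ⁿ ≤ 2ⁿ⁻¹ (Σⱼ P k j ‖vⱼ − u‖ⁿ + Σⱼ qⱼ ‖vⱼ − u‖ⁿ)` (convexity of `xⁿ`, Jensen). -/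
theorem norm_g_pow_le (hq0 : ∀ i, 0 ≤ q i) (hq1 : ∑ i, q i = 1) (hP0 : ∀ k j, 0 ≤ P k j)
    (hP1 : ∀ k, ∑ j, P k j = 1) (hg : g = fun k v => ∑ j, (P k j - q j) • (v j - u)) (k : Fin (N + 1))
    (v : Fin (N + 1) → V3) (n : ℕ) :
    ‖g k v‖ ^ n ≤ 2 ^ (n - 1) * ((∑ j, P k j * ‖v j - u‖ ^ n) + ∑ j, q j * ‖v j - u‖ ^ n) := by
  have ha : 0 ≤ ∑ j, P k j * ‖v j - u‖ ^ 1 := Finset.sum_nonneg fun j _ => mul_nonneg (hP0 k j) (by positivity)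
  have hb : 0 ≤ ∑ j, q j * ‖v j - u‖ ^ 1 := Finset.sum_nonneg fun j _ => mul_nonneg (hq0 j) (by positivity)
  calc ‖g k v‖ ^ n ≤ ((∑ j, P k j * ‖v j - u‖ ^ 1) + ∑ j, q j * ‖v j - u‖ ^ 1) ^ n :=
        pow_le_pow_left₀ (norm_nonneg _) (norm_g_le u q P g hq0 hP0 hg k v) n
    _ ≤ 2 ^ (n - 1) * ((∑ j, P k j * ‖v j - u‖ ^ 1) ^ n + (∑ j, q j * ‖v j - u‖ ^ 1) ^ n) := add_pow_le ha hb n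
    _ ≤ 2 ^ (n - 1) * ((∑ j, P k j * ‖v j - u‖ ^ n) + ∑ j, q j * ‖v j - u‖ ^ n) := by
        gcongr
        · calc (∑ j, P k j * ‖v j - u‖ ^ 1) ^ n ≤ ∑ j, P k j * (‖v j - u‖ ^ 1) ^ n :=
                jensen_pow (P k) (hP0 k) (hP1 k) (fun j => by positivity) n
            _ = _ := by simp_rw [pow_one]
        · calc (∑ j, q j * ‖v j - u‖ ^ 1) ^ n ≤ ∑ j, q j * (‖v j - u‖ ^ 1) ^ n :=
                jensen_pow q hq0 hq1 (fun j => by positivity) n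
            _ = _ := by simp_rw [pow_one]

/-- `‖d_k‖ⁿ ≤ 2ⁿ⁻¹ (‖v_k − u‖ⁿ + Σⱼ P k j ‖vⱼ − u‖ⁿ)`. -/
theorem norm_d_pow_le (hP0 : ∀ k j, 0 ≤ P k j) (hP1 : ∀ k, ∑ j, P k j = 1)
    (hd : d = fun k v => (v k - u) - ∑ j, P k j • (v j - u)) (k : Fin (N + 1)) (v : Fin (N + 1) → V3) (n : ℕ) :
    ‖d k v‖ ^ n ≤ 2 ^ (n - 1) * (‖v k - u‖ ^ n + ∑ j, P k j * ‖v j - u‖ ^ n) := by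
  have hb : 0 ≤ ∑ j, P k j * ‖v j - u‖ ^ 1 := Finset.sum_nonneg fun j _ => mul_nonneg (hP0 k j) (by positivity)
  calc ‖d k v‖ ^ n ≤ (‖v k - u‖ ^ 1 + ∑ j, P k j * ‖v j - u‖ ^ 1) ^ n :=
        pow_le_pow_left₀ (norm_nonneg _) (norm_d_le u P d hP0 hd k v) n
    _ ≤ 2 ^ (n - 1) * ((‖v k - u‖ ^ 1) ^ n + (∑ j, P k j * ‖v j - u‖ ^ 1) ^ n) := add_pow_le (by positivity) hb n
    _ ≤ 2 ^ (n - 1) * (‖v k - u‖ ^ n + ∑ j, P k j * ‖v j - u‖ ^ n) := by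
        gcongr
        · rw [pow_one]
        · calc (∑ j, P k j * ‖v j - u‖ ^ 1) ^ n ≤ ∑ j, P k j * (‖v j - u‖ ^ 1) ^ n :=
                jensen_pow (P k) (hP0 k) (hP1 k) (fun j => by positivity) n
            _ = _ := by simp_rw [pow_one]

/-- Two-term domination: if `h ≤ 2ⁿ⁻¹ (X + Y)` pointwise with `E X = E Y = m` (`n ≥ 1`), then `E h ≤ 2ⁿ m`. -/
theorem lintegral_le_of_le_two_terms {h X Y : (Fin (N + 1) → V3) → ℝ} (hX0 : ∀ v, 0 ≤ X v) (hY0 : ∀ v, 0 ≤ Y v)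
    (hXm : Measurable fun v => ENNReal.ofReal (X v)) {n : ℕ} (hn : 1 ≤ n)
    (hle : ∀ v, h v ≤ 2 ^ (n - 1) * (X v + Y v)) {m : ℝ} (hm : 0 ≤ m)
    (hX : ∫⁻ v, ENNReal.ofReal (X v) ∂(Measure.pi fun _ : Fin (N + 1) => gaussMeasure u θ) = ENNReal.ofReal m)
    (hY : ∫⁻ v, ENNReal.ofReal (Y v) ∂(Measure.pi fun _ : Fin (N + 1) => gaussMeasure u θ) = ENNReal.ofReal m) :
    ∫⁻ v, ENNReal.ofReal (h v) ∂(Measure.pi fun _ : Fin (N + 1) => gaussMeasure u θ) ≤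
      ENNReal.ofReal (2 ^ n * m) := by
  set μ := Measure.pi fun _ : Fin (N + 1) => gaussMeasure u θ with hμ
  have h1 : ∀ v, ENNReal.ofReal (2 ^ (n - 1) * (X v + Y v)) =
      ENNReal.ofReal (2 ^ (n - 1)) * (ENNReal.ofReal (X v) + ENNReal.ofReal (Y v)) := fun v => by
    rw [ENNReal.ofReal_mul (by positivity), ENNReal.ofReal_add (hX0 v) (hY0 v)]
  calc ∫⁻ v, ENNReal.ofReal (h v) ∂μ ≤ ∫⁻ v, ENNReal.ofReal (2 ^ (n - 1) * (X v + Y v)) ∂μ :=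
        lintegral_mono fun v => ENNReal.ofReal_le_ofReal (hle v)
    _ = ENNReal.ofReal (2 ^ (n - 1)) * (ENNReal.ofReal m + ENNReal.ofReal m) := by
        simp_rw [h1]
        rw [lintegral_const_mul' _ _ ENNReal.ofReal_ne_top, lintegral_add_left hXm, hX, hY]
    _ = ENNReal.ofReal (2 ^ n * m) := by
        rw [← ENNReal.ofReal_add hm hm, ← ENNReal.ofReal_mul (by positivity)]
        congr 1
        have h2 : (2 : ℝ) ^ (n - 1) * 2 = 2 ^ n := by rw [← pow_succ, Nat.sub_add_cancel hn]
        rw [← two_mul, ← mul_assoc, h2]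

/-- `E ‖g_k‖ⁿ ≤ 2ⁿ m_n` (`n ≥ 1`). -/
theorem lintegral_norm_g_pow_le (hq0 : ∀ i, 0 ≤ q i) (hq1 : ∑ i, q i = 1) (hP0 : ∀ k j, 0 ≤ P k j)
    (hP1 : ∀ k, ∑ j, P k j = 1) (hg : g = fun k v => ∑ j, (P k j - q j) • (v j - u)) (k : Fin (N + 1)) {n : ℕ}
    (hn : 1 ≤ n) :
    ∫⁻ v, ENNReal.ofReal (‖g k v‖ ^ n) ∂(Measure.pi fun _ : Fin (N + 1) => gaussMeasure u θ) ≤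
      ENNReal.ofReal (2 ^ n * ∫ w, ‖w - u‖ ^ n ∂gaussMeasure u θ) := by
  have hX := EqRung.lintegral_P u θ (P k) (fun m v => ∑ j, P k j * ‖v j - u‖ ^ m) (hP0 k) rfl n
  have hY := EqRung.lintegral_P u θ q (fun m v => ∑ j, q j * ‖v j - u‖ ^ m) hq0 rfl n
  rw [hP1 k, one_mul] at hX
  rw [hq1, one_mul] at hY
  exact lintegral_le_of_le_two_terms u θ (fun v => Finset.sum_nonneg fun j _ => mul_nonneg (hP0 k j) (by positivity))
    (fun v => Finset.sum_nonneg fun j _ => mul_nonneg (hq0 j) (by positivity))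
    (by fun_prop : Continuous fun v : Fin (N + 1) → V3 => ∑ j, P k j * ‖v j - u‖ ^ n).measurable.ennreal_ofReal hn
    (norm_g_pow_le u q P g hq0 hq1 hP0 hP1 hg k · n) (EqRung.integral_norm_sub_pow_nonneg u θ n) hX hY

/-- `E ‖d_k‖ⁿ ≤ 2ⁿ m_n` (`n ≥ 1`). -/
theorem lintegral_norm_d_pow_le (hP0 : ∀ k j, 0 ≤ P k j) (hP1 : ∀ k, ∑ j, P k j = 1)
    (hd : d = fun k v => (v k - u) - ∑ j, P k j • (v j - u)) (k : Fin (N + 1)) {n : ℕ} (hn : 1 ≤ n) :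
    ∫⁻ v, ENNReal.ofReal (‖d k v‖ ^ n) ∂(Measure.pi fun _ : Fin (N + 1) => gaussMeasure u θ) ≤
      ENNReal.ofReal (2 ^ n * ∫ w, ‖w - u‖ ^ n ∂gaussMeasure u θ) := by
  have h1m : Measurable fun v : Fin (N + 1) → V3 => ENNReal.ofReal (‖v k - u‖ ^ n) :=
    (by fun_prop : Continuous fun v : Fin (N + 1) → V3 => ‖v k - u‖ ^ n).measurable.ennreal_ofReal
  have hX : ∫⁻ v, ENNReal.ofReal (‖v k - u‖ ^ n) ∂(Measure.pi fun _ : Fin (N + 1) => gaussMeasure u θ) =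
      ENNReal.ofReal (∫ w, ‖w - u‖ ^ n ∂gaussMeasure u θ) := by
    rw [EqRung.lintegral_comp_eval u θ k (g := fun w => ENNReal.ofReal (‖w - u‖ ^ n))
      ((by fun_prop : Continuous fun w : V3 => ‖w - u‖ ^ n).measurable.ennreal_ofReal)]
    exact EqRung.lintegral_norm_sub_pow u θ n
  have hY := EqRung.lintegral_P u θ (P k) (fun m v => ∑ j, P k j * ‖v j - u‖ ^ m) (hP0 k) rfl n
  rw [hP1 k, one_mul] at hY
  exact lintegral_le_of_le_two_terms u θ (fun v => by positivity)
    (fun v => Finset.sum_nonneg fun j _ => mul_nonneg (hP0 k j) (by positivity)) h1m hn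
    (norm_d_pow_le u P d hP0 hP1 hd k · n) (EqRung.integral_norm_sub_pow_nonneg u θ n) hX hY

/-! ## The exact second moment of the sub-block velocities -/

/-- `E Σ_k q_k ‖g_k‖² = 3θ Σ_k q_k s_k`, `s_k = Σⱼ (P k j − q j)²` (independent centred Gaussians: the variance of a
linear combination with SIGNED coefficients). -/
theorem lintegral_A_eq (hθ : 0 < θ) (hq0 : ∀ i, 0 ≤ q i)
    (hg : g = fun k v => ∑ j, (P k j - q j) • (v j - u)) :
    ∫⁻ v, ENNReal.ofReal (∑ k, q k * ‖g k v‖ ^ 2) ∂(Measure.pi fun _ : Fin (N + 1) => gaussMeasure u θ) =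
      ENNReal.ofReal (3 * θ * ∑ k, q k * ∑ j, (P k j - q j) ^ 2) := by
  set μ := Measure.pi fun _ : Fin (N + 1) => gaussMeasure u θ with hμ
  have hgk : ∀ k, g k = fun v => ∑ j, (P k j - q j) • (v j - u) := fun k => by rw [hg]
  have hcont : ∀ k, Continuous (g k) := fun k => by rw [hgk k]; fun_prop
  have hmk : ∀ k, Measurable fun v : Fin (N + 1) → V3 => ENNReal.ofReal (q k) * ENNReal.ofReal (‖g k v‖ ^ 2) :=
    fun k => ((hcont k).norm.pow 2).measurable.ennreal_ofReal.const_mul _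
  have hsplit : ∀ v : Fin (N + 1) → V3, ENNReal.ofReal (∑ k, q k * ‖g k v‖ ^ 2) =
      ∑ k, ENNReal.ofReal (q k) * ENNReal.ofReal (‖g k v‖ ^ 2) := by
    intro v
    rw [ENNReal.ofReal_sum_of_nonneg fun k _ => mul_nonneg (hq0 k) (sq_nonneg _)]
    exact Finset.sum_congr rfl fun k _ => ENNReal.ofReal_mul (hq0 k)
  simp_rw [hsplit]
  rw [lintegral_finsetSum _ fun k _ => hmk k]
  have hk : ∀ k, ∫⁻ v, ENNReal.ofReal (q k) * ENNReal.ofReal (‖g k v‖ ^ 2) ∂μ =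
      ENNReal.ofReal (q k * (3 * θ * ∑ j, (P k j - q j) ^ 2)) := by
    intro k
    rw [lintegral_const_mul' _ _ ENNReal.ofReal_ne_top, hμ,
      EqRung.lintegral_norm_eta_sq u θ (fun j => P k j - q j) (g k) (hgk k) hθ, ← ENNReal.ofReal_mul (hq0 k)]
  simp_rw [hk]
  rw [← ENNReal.ofReal_sum_of_nonneg fun k _ => mul_nonneg (hq0 k)
    (mul_nonneg (by positivity) (Finset.sum_nonneg fun j _ => sq_nonneg _))]
  congr 1
  rw [Finset.mul_sum]
  exact Finset.sum_congr rfl fun k _ => by ring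

/-! ## Cauchy–Schwarz split of `T · R` and the crude envelope -/

/-- Pointwise Cauchy–Schwarz in `k`: `(T·R)² ≤ (Σ_k q_k ‖g_k‖²) · Σ_k q_k ((‖g_k‖ + ‖g_k‖³) T)²`. -/
theorem TR_sq_le (hq0 : ∀ i, 0 ≤ q i) (hR : R = fun v => ∑ k, q k * (‖g k v‖ ^ 2 + ‖g k v‖ ^ 4))
    (v : Fin (N + 1) → V3) :
    (T v * R v) ^ 2 ≤ (∑ k, q k * ‖g k v‖ ^ 2) * ∑ k, q k * ((‖g k v‖ + ‖g k v‖ ^ 3) * T v) ^ 2 := by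
  have hTR : T v * R v = ∑ k, q k * ‖g k v‖ * ((‖g k v‖ + ‖g k v‖ ^ 3) * T v) := by
    rw [hR]
    dsimp only
    rw [Finset.mul_sum]
    exact Finset.sum_congr rfl fun k _ => by ring
  rw [hTR]
  refine Finset.sum_sq_le_sum_mul_sum_of_sq_le_mul Finset.univ
    (fun k _ => mul_nonneg (hq0 k) (sq_nonneg _)) (fun k _ => mul_nonneg (hq0 k) (sq_nonneg _)) fun k _ => ?_
  have : (q k * ‖g k v‖ * ((‖g k v‖ + ‖g k v‖ ^ 3) * T v)) ^ 2 =
      q k * ‖g k v‖ ^ 2 * (q k * ((‖g k v‖ + ‖g k v‖ ^ 3) * T v) ^ 2) := by ring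
  rw [this]

/-- `(1 + b + c + e)⁴ ≤ 64 (1 + b⁴ + c⁴ + e⁴)` for `b, c, e ≥ 0` (power mean). -/
theorem add_four_pow_four_le {b c e : ℝ} (hb : 0 ≤ b) (hc : 0 ≤ c) (he : 0 ≤ e) :
    (1 + b + c + e) ^ 4 ≤ 64 * (1 + b ^ 4 + c ^ 4 + e ^ 4) := by
  have h1 : (1 + b + c + e) ^ 4 ≤ 2 ^ 3 * ((1 + b) ^ 4 + (c + e) ^ 4) := by
    have := add_pow_le (show (0 : ℝ) ≤ 1 + b by positivity) (show 0 ≤ c + e by positivity) 4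
    rw [show (1 : ℝ) + b + c + e = (1 + b) + (c + e) by ring]
    simpa using this
  have h2 : (1 + b) ^ 4 ≤ 2 ^ 3 * (1 ^ 4 + b ^ 4) := by simpa using add_pow_le zero_le_one hb 4
  have h3 : (c + e) ^ 4 ≤ 2 ^ 3 * (c ^ 4 + e ^ 4) := by simpa using add_pow_le hc he 4
  nlinarith [h1, h2, h3]

/-- The crude pointwise envelope: with `T = Σᵢ qᵢ (1 + ‖dᵢ‖² + ‖dᵢ‖⁴ + ‖gᵢ‖²)`,
`Σ_k q_k ((‖g_k‖ + ‖g_k‖³) T)² ≤ Σᵢ qᵢ (104 + 64 ‖dᵢ‖¹⁶ + 40 ‖gᵢ‖¹⁶)`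
(`T²V ≤ (T⁴ + V²)/2`, Jensen twice, `(a+b)⁴ ≤ 8(a⁴+b⁴)`, `xᵃ ≤ 1 + x¹⁶`). -/
theorem B_le (hq0 : ∀ i, 0 ≤ q i) (hq1 : ∑ i, q i = 1)
    (hT : T = fun v => ∑ i, q i * (1 + ‖d i v‖ ^ 2 + ‖d i v‖ ^ 4 + ‖g i v‖ ^ 2)) (v : Fin (N + 1) → V3) :
    ∑ k, q k * ((‖g k v‖ + ‖g k v‖ ^ 3) * T v) ^ 2 ≤
      ∑ i, q i * (104 + 64 * ‖d i v‖ ^ 16 + 40 * ‖g i v‖ ^ 16) := by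
  set V : ℝ := ∑ k, q k * (‖g k v‖ + ‖g k v‖ ^ 3) ^ 2 with hV
  have hB : ∑ k, q k * ((‖g k v‖ + ‖g k v‖ ^ 3) * T v) ^ 2 = T v ^ 2 * V := by
    rw [hV, Finset.mul_sum]
    exact Finset.sum_congr rfl fun k _ => by ring
  -- `T⁴ ≤ Σ qᵢ Uᵢ⁴ ≤ 64 Σ qᵢ (1 + ‖dᵢ‖⁸ + ‖dᵢ‖¹⁶ + ‖gᵢ‖⁸)`
  have hT4 : T v ^ 4 ≤ ∑ i, q i * (64 * (1 + ‖d i v‖ ^ 8 + ‖d i v‖ ^ 16 + ‖g i v‖ ^ 8)) := by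
    have hTv : T v = ∑ i, q i * (1 + ‖d i v‖ ^ 2 + ‖d i v‖ ^ 4 + ‖g i v‖ ^ 2) := by rw [hT]
    rw [hTv]
    calc (∑ i, q i * (1 + ‖d i v‖ ^ 2 + ‖d i v‖ ^ 4 + ‖g i v‖ ^ 2)) ^ 4
        ≤ ∑ i, q i * (1 + ‖d i v‖ ^ 2 + ‖d i v‖ ^ 4 + ‖g i v‖ ^ 2) ^ 4 :=
          jensen_pow q hq0 hq1 (fun i => by positivity) 4
      _ ≤ ∑ i, q i * (64 * (1 + ‖d i v‖ ^ 8 + ‖d i v‖ ^ 16 + ‖g i v‖ ^ 8)) :=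
          Finset.sum_le_sum fun i _ => mul_le_mul_of_nonneg_left (by
            have h := add_four_pow_four_le (b := ‖d i v‖ ^ 2) (c := ‖d i v‖ ^ 4) (e := ‖g i v‖ ^ 2)
              (by positivity) (by positivity) (by positivity)
            simpa only [← pow_mul] using h) (hq0 i)
  -- `V² ≤ Σ q_k (‖g_k‖ + ‖g_k‖³)⁴ ≤ 8 Σ q_k (‖g_k‖⁴ + ‖g_k‖¹²)`
  have hV2 : V ^ 2 ≤ ∑ k, q k * (8 * (‖g k v‖ ^ 4 + ‖g k v‖ ^ 12)) := by
    calc V ^ 2 ≤ ∑ k, q k * ((‖g k v‖ + ‖g k v‖ ^ 3) ^ 2) ^ 2 :=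
          jensen_pow q hq0 hq1 (fun k => by positivity) 2
      _ ≤ ∑ k, q k * (8 * (‖g k v‖ ^ 4 + ‖g k v‖ ^ 12)) :=
          Finset.sum_le_sum fun k _ => mul_le_mul_of_nonneg_left (by
            have h := add_pow_le (norm_nonneg (g k v)) (show 0 ≤ ‖g k v‖ ^ 3 by positivity) 4
            rw [← pow_mul]
            calc (‖g k v‖ + ‖g k v‖ ^ 3) ^ (2 * 2) = (‖g k v‖ + ‖g k v‖ ^ 3) ^ 4 := by norm_num
              _ ≤ 2 ^ (4 - 1) * (‖g k v‖ ^ 4 + (‖g k v‖ ^ 3) ^ 4) := h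
              _ = 8 * (‖g k v‖ ^ 4 + ‖g k v‖ ^ 12) := by norm_num [← pow_mul]) (hq0 k)
  have hTV : T v ^ 2 * V ≤ (T v ^ 4 + V ^ 2) / 2 := by nlinarith [sq_nonneg (T v ^ 2 - V)]
  -- collect, then absorb the lower powers into `1 + x¹⁶`
  have hpt : ∀ i, (64 * (1 + ‖d i v‖ ^ 8 + ‖d i v‖ ^ 16 + ‖g i v‖ ^ 8) + 8 * (‖g i v‖ ^ 4 + ‖g i v‖ ^ 12)) / 2 ≤
      104 + 64 * ‖d i v‖ ^ 16 + 40 * ‖g i v‖ ^ 16 := by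
    -- `yᵃ ≤ 1 + yᵇ` for `y ≥ 0`, `a ≤ b`
    have hp : ∀ y : ℝ, 0 ≤ y → ∀ a b : ℕ, a ≤ b → y ^ a ≤ 1 + y ^ b := fun y hy a b hab => by
      rcases le_total y 1 with h1 | h1
      · exact (pow_le_one₀ hy h1).trans (le_add_of_nonneg_right (by positivity))
      · exact (pow_le_pow_right₀ h1 hab).trans (le_add_of_nonneg_left zero_le_one)
    intro i
    have h1 := hp _ (norm_nonneg (d i v)) 8 16 (by norm_num)
    have h2 := hp _ (norm_nonneg (g i v)) 8 16 (by norm_num)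
    have h3 := hp _ (norm_nonneg (g i v)) 4 16 (by norm_num)
    have h4 := hp _ (norm_nonneg (g i v)) 12 16 (by norm_num)
    linarith
  rw [hB]
  calc T v ^ 2 * V ≤ (T v ^ 4 + V ^ 2) / 2 := hTV
    _ ≤ ((∑ i, q i * (64 * (1 + ‖d i v‖ ^ 8 + ‖d i v‖ ^ 16 + ‖g i v‖ ^ 8))) +
          ∑ k, q k * (8 * (‖g k v‖ ^ 4 + ‖g k v‖ ^ 12))) / 2 := by gcongr
    _ = ∑ i, q i * ((64 * (1 + ‖d i v‖ ^ 8 + ‖d i v‖ ^ 16 + ‖g i v‖ ^ 8) +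
          8 * (‖g i v‖ ^ 4 + ‖g i v‖ ^ 12)) / 2) := by
        rw [← Finset.sum_add_distrib, Finset.sum_div]
        exact Finset.sum_congr rfl fun i _ => by ring
    _ ≤ ∑ i, q i * (104 + 64 * ‖d i v‖ ^ 16 + 40 * ‖g i v‖ ^ 16) :=
        Finset.sum_le_sum fun i _ => mul_le_mul_of_nonneg_left (hpt i) (hq0 i)

/-- The crude moment: `E Σ_k q_k ((‖g_k‖ + ‖g_k‖³) T)² ≤ K₀ = 104 (1 + 2¹⁶ m₁₆)` (finite). -/
theorem lintegral_B_le (hq0 : ∀ i, 0 ≤ q i) (hq1 : ∑ i, q i = 1) (hP0 : ∀ k j, 0 ≤ P k j)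
    (hP1 : ∀ k, ∑ j, P k j = 1) (hg : g = fun k v => ∑ j, (P k j - q j) • (v j - u))
    (hd : d = fun k v => (v k - u) - ∑ j, P k j • (v j - u))
    (hT : T = fun v => ∑ i, q i * (1 + ‖d i v‖ ^ 2 + ‖d i v‖ ^ 4 + ‖g i v‖ ^ 2)) :
    ∫⁻ v, ENNReal.ofReal (∑ k, q k * ((‖g k v‖ + ‖g k v‖ ^ 3) * T v) ^ 2)
        ∂(Measure.pi fun _ : Fin (N + 1) => gaussMeasure u θ) ≤
      104 * (1 + ENNReal.ofReal (2 ^ 16 * ∫ w, ‖w - u‖ ^ 16 ∂gaussMeasure u θ)) := by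
  set μ := Measure.pi fun _ : Fin (N + 1) => gaussMeasure u θ with hμ
  haveI : IsProbabilityMeasure μ := by rw [hμ]; infer_instance
  have hgk : ∀ k, Continuous (g k) := fun k => by rw [hg]; fun_prop
  have hdk : ∀ k, Continuous (d k) := fun k => by rw [hd]; fun_prop
  have mg : ∀ k, Measurable fun v : Fin (N + 1) → V3 => ENNReal.ofReal (‖g k v‖ ^ 16) :=
    fun k => ((hgk k).norm.pow 16).measurable.ennreal_ofReal
  have md : ∀ k, Measurable fun v : Fin (N + 1) → V3 => ENNReal.ofReal (‖d k v‖ ^ 16) :=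
    fun k => ((hdk k).norm.pow 16).measurable.ennreal_ofReal
  set M16 : ℝ≥0∞ := ENNReal.ofReal (2 ^ 16 * ∫ w, ‖w - u‖ ^ 16 ∂gaussMeasure u θ) with hM16
  have Eg : ∀ k, ∫⁻ v, ENNReal.ofReal (‖g k v‖ ^ 16) ∂μ ≤ M16 :=
    fun k => lintegral_norm_g_pow_le u θ q P g hq0 hq1 hP0 hP1 hg k (by norm_num)
  have Ed : ∀ k, ∫⁻ v, ENNReal.ofReal (‖d k v‖ ^ 16) ∂μ ≤ M16 :=
    fun k => lintegral_norm_d_pow_le u θ P d hP0 hP1 hd k (by norm_num)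
  -- per particle: the envelope integrates to at most `K₀`
  have henv : ∀ i, ∫⁻ v, ENNReal.ofReal (104 + 64 * ‖d i v‖ ^ 16 + 40 * ‖g i v‖ ^ 16) ∂μ ≤ 104 * (1 + M16) := by
    intro i
    have hpt : ∀ v : Fin (N + 1) → V3, ENNReal.ofReal (104 + 64 * ‖d i v‖ ^ 16 + 40 * ‖g i v‖ ^ 16) =
        104 + 64 * ENNReal.ofReal (‖d i v‖ ^ 16) + 40 * ENNReal.ofReal (‖g i v‖ ^ 16) := by
      intro v
      rw [ENNReal.ofReal_add (by positivity) (by positivity), ENNReal.ofReal_add (by positivity) (by positivity),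
        ENNReal.ofReal_mul (by norm_num), ENNReal.ofReal_mul (by norm_num)]
      norm_num
    simp_rw [hpt]
    have m1 : Measurable fun v : Fin (N + 1) → V3 => (104 : ℝ≥0∞) + 64 * ENNReal.ofReal (‖d i v‖ ^ 16) :=
      measurable_const.add ((md i).const_mul _)
    rw [lintegral_add_left m1, lintegral_add_left measurable_const, lintegral_const, measure_univ, mul_one,
      lintegral_const_mul' _ _ (by norm_num), lintegral_const_mul' _ _ (by norm_num)]
    calc (104 : ℝ≥0∞) + 64 * ∫⁻ v, ENNReal.ofReal (‖d i v‖ ^ 16) ∂μ + 40 * ∫⁻ v, ENNReal.ofReal (‖g i v‖ ^ 16) ∂μ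
        ≤ 104 + 64 * M16 + 40 * M16 := by gcongr <;> first | exact Ed i | exact Eg i
      _ = 104 * (1 + M16) := by ring
  -- sum over particles with the convex weights `q`
  have hmi : ∀ i, Measurable fun v : Fin (N + 1) → V3 =>
      ENNReal.ofReal (104 + 64 * ‖d i v‖ ^ 16 + 40 * ‖g i v‖ ^ 16) := fun i =>
    (by fun_prop : Continuous fun v : Fin (N + 1) → V3 =>
      104 + 64 * ‖d i v‖ ^ 16 + 40 * ‖g i v‖ ^ 16).measurable.ennreal_ofReal
  calc ∫⁻ v, ENNReal.ofReal (∑ k, q k * ((‖g k v‖ + ‖g k v‖ ^ 3) * T v) ^ 2) ∂μ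
      ≤ ∫⁻ v, ENNReal.ofReal (∑ i, q i * (104 + 64 * ‖d i v‖ ^ 16 + 40 * ‖g i v‖ ^ 16)) ∂μ :=
        lintegral_mono fun v => ENNReal.ofReal_le_ofReal (B_le q g d T hq0 hq1 hT v)
    _ = ∑ i, ENNReal.ofReal (q i) * ∫⁻ v, ENNReal.ofReal (104 + 64 * ‖d i v‖ ^ 16 + 40 * ‖g i v‖ ^ 16) ∂μ := by
        have hsplit : ∀ v : Fin (N + 1) → V3,
            ENNReal.ofReal (∑ i, q i * (104 + 64 * ‖d i v‖ ^ 16 + 40 * ‖g i v‖ ^ 16)) =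
            ∑ i, ENNReal.ofReal (q i) * ENNReal.ofReal (104 + 64 * ‖d i v‖ ^ 16 + 40 * ‖g i v‖ ^ 16) := by
          intro v
          rw [ENNReal.ofReal_sum_of_nonneg fun i _ => mul_nonneg (hq0 i) (by positivity)]
          exact Finset.sum_congr rfl fun i _ => ENNReal.ofReal_mul (hq0 i)
        simp_rw [hsplit]
        rw [lintegral_finsetSum _ fun i _ => (hmi i).const_mul _]
        exact Finset.sum_congr rfl fun i _ => lintegral_const_mul' _ _ ENNReal.ofReal_ne_top
    _ ≤ ∑ i, ENNReal.ofReal (q i) * (104 * (1 + M16)) := Finset.sum_le_sum fun i _ => mul_le_mul_right (henv i) _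
    _ = 104 * (1 + M16) := by
        rw [← Finset.sum_mul, ← ENNReal.ofReal_sum_of_nonneg fun i _ => hq0 i, hq1, ENNReal.ofReal_one, one_mul]

/-- **MAIN RESULT.** The energy-weighted Reynolds factor under independent Gaussian velocities:
`E (T · R) ≤ (3θ Σ_k q_k Σⱼ (P k j − q j)²)^{1/2} · K₀^{1/2}`. -/
theorem lintegral_TR_le (hθ : 0 < θ) (hq0 : ∀ i, 0 ≤ q i) (hq1 : ∑ i, q i = 1) (hP0 : ∀ k j, 0 ≤ P k j)
    (hP1 : ∀ k, ∑ j, P k j = 1) (hg : g = fun k v => ∑ j, (P k j - q j) • (v j - u))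
    (hd : d = fun k v => (v k - u) - ∑ j, P k j • (v j - u))
    (hT : T = fun v => ∑ i, q i * (1 + ‖d i v‖ ^ 2 + ‖d i v‖ ^ 4 + ‖g i v‖ ^ 2))
    (hR : R = fun v => ∑ k, q k * (‖g k v‖ ^ 2 + ‖g k v‖ ^ 4)) :
    ∫⁻ v, ENNReal.ofReal (T v * R v) ∂(Measure.pi fun _ : Fin (N + 1) => gaussMeasure u θ) ≤
      ENNReal.ofReal (3 * θ * ∑ k, q k * ∑ j, (P k j - q j) ^ 2) ^ (1 / 2 : ℝ) *
        (104 * (1 + ENNReal.ofReal (2 ^ 16 * ∫ w, ‖w - u‖ ^ 16 ∂gaussMeasure u θ))) ^ (1 / 2 : ℝ) := by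
  set μ := Measure.pi fun _ : Fin (N + 1) => gaussMeasure u θ with hμ
  have hgk : ∀ k, Continuous (g k) := fun k => by rw [hg]; fun_prop
  have hdk : ∀ k, Continuous (d k) := fun k => by rw [hd]; fun_prop
  have hTc : Continuous T := by rw [hT]; fun_prop
  -- the two sides of the split
  set A : (Fin (N + 1) → V3) → ℝ := fun v => ∑ k, q k * ‖g k v‖ ^ 2 with hA
  set B : (Fin (N + 1) → V3) → ℝ := fun v => ∑ k, q k * ((‖g k v‖ + ‖g k v‖ ^ 3) * T v) ^ 2 with hB
  have hA0 : ∀ v, 0 ≤ A v := fun v => Finset.sum_nonneg fun k _ => mul_nonneg (hq0 k) (sq_nonneg _)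
  have hB0 : ∀ v, 0 ≤ B v := fun v => Finset.sum_nonneg fun k _ => mul_nonneg (hq0 k) (sq_nonneg _)
  have hAc : Continuous A := by rw [hA]; fun_prop
  have hBc : Continuous B := by rw [hB]; fun_prop
  have hT0 : ∀ v, 0 ≤ T v := fun v => by
    rw [hT]; exact Finset.sum_nonneg fun i _ => mul_nonneg (hq0 i) (by positivity)
  have hR0 : ∀ v, 0 ≤ R v := fun v => by
    rw [hR]; exact Finset.sum_nonneg fun k _ => mul_nonneg (hq0 k) (by positivity)
  -- pointwise: `T R ≤ √A √B`
  have hpt : ∀ v, T v * R v ≤ Real.sqrt (A v) * Real.sqrt (B v) := by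
    intro v
    rw [← Real.sqrt_mul (hA0 v)]
    refine Real.le_sqrt_of_sq_le ?_
    exact TR_sq_le q g T R hq0 hR v
  calc ∫⁻ v, ENNReal.ofReal (T v * R v) ∂μ ≤ ∫⁻ v, ENNReal.ofReal (Real.sqrt (A v) * Real.sqrt (B v)) ∂μ :=
        lintegral_mono fun v => ENNReal.ofReal_le_ofReal (hpt v)
    _ ≤ (∫⁻ v, ENNReal.ofReal (Real.sqrt (A v) ^ 2) ∂μ) ^ (1 / 2 : ℝ) *
          (∫⁻ v, ENNReal.ofReal (Real.sqrt (B v) ^ 2) ∂μ) ^ (1 / 2 : ℝ) :=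
        EqRung.lintegral_ofReal_mul_le μ (Real.continuous_sqrt.comp hAc).measurable
          (Real.continuous_sqrt.comp hBc).measurable (fun v => Real.sqrt_nonneg _) (fun v => Real.sqrt_nonneg _)
    _ = (∫⁻ v, ENNReal.ofReal (A v) ∂μ) ^ (1 / 2 : ℝ) * (∫⁻ v, ENNReal.ofReal (B v) ∂μ) ^ (1 / 2 : ℝ) := by
        simp_rw [Real.sq_sqrt (hA0 _), Real.sq_sqrt (hB0 _)]
    _ ≤ _ := by
        rw [hA, hμ, lintegral_A_eq u θ q P g hθ hq0 hg]
        gcongr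
        exact lintegral_B_le u θ q P g d T hq0 hq1 hP0 hP1 hg hd hT

end Reynolds

/-! ## Registered anchor of this support file -/

open Reynolds in
/-- ANCHOR (`stub_reynolds_gauss_anchor`): the exact second moment of the sub-block velocities under independent
Gaussian velocities, `E Σ_k q_k ‖Σⱼ (P k j − q j)(vⱼ − u)‖² = 3θ Σ_k q_k Σⱼ (P k j − q j)²` (signed coefficients). -/
theorem stub_reynolds_gauss_anchor : ∀ (u : V3) (θ : ℝ), 0 < θ → ∀ (N : ℕ) (q : Fin (N + 1) → ℝ)
    (P : Fin (N + 1) → Fin (N + 1) → ℝ), (∀ i, 0 ≤ q i) →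
      ∫⁻ v, ENNReal.ofReal (∑ k, q k * ‖∑ j, (P k j - q j) • (v j - u)‖ ^ 2)
          ∂(Measure.pi fun _ : Fin (N + 1) => Literature.MathematicalPhysics.KineticTheory.gaussMeasure u θ) =
        ENNReal.ofReal (3 * θ * ∑ k, q k * ∑ j, (P k j - q j) ^ 2) :=
  fun u θ hθ _ q P hq0 => lintegral_A_eq u θ q P (fun k v => ∑ j, (P k j - q j) • (v j - u)) hθ hq0 rfl

end

end Summit.AtomisticToContinuum.HydrodynamicLimit.Theorems.SustainedAnisotropy
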